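import Summits.ResolutionOfSingularities.ResolutionOfSingularities.Theorems.WeightedInvariantIota3CriticalTriple
import Summits.ResolutionOfSingularities.ResolutionOfSingularities.Theorems.WeightedInvariantIota3JSigmaDominanceSecondMember
import HarnessLib

/-!
# THE RESIDUE hres₃ AT THE CRITICAL TRIPLE: (E1) there, one-sided comparison of the two critical filtrations, and purity with both
# error terms (door `HypersurfaceCentreConstruction`, stmt-ResolutionOfSingularities-19897; brick 5 of hres₃ of `keyRungGrHomLE_three_of_residue3`)

Helper for `stub_keyRungGrHomLE_three` (def-free, `--supports 19897`).  Sequel of …Iota3CriticalTriple (level `qj` of the second member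
`g₂'`, critical triple `F₃ = F_{(g₁,g₂; r₂, j r₁, j r₂)}`) and …Iota3RatioMaxNonSolvable (LEMMA B).  Here, in a regular local ring of
dimension three with `𝔪 = (x, g₂, g₁)`:

* `critical_comparison` — if both two-flags `(g₁,g₂)`, `(g₁',g₂')` carry `f ∉ 𝔪^{ν+1}` to level `r₁ν` of `(q; r₁, r₂)` (`q < r₂ < r₁`) and
  `g₂' ∈ F(qj)` with `qj < r₂`, then at the critical triple `g₂' ∈ F₃(j r₂)`, `g₁' ∈ F₃(j r₁)` ((E1) `Iota3.mem_weight₁_of_mem_weight₂` at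
  `(r₂; j r₁, j r₂)`) and `F'₃(n) ≤ F₃(n)` for all `n` (multiplicativity upgrade): THE TWO FLAGS HAVE COMPARABLE CRITICAL FILTRATIONS although
  `g₂' ∉ F(r₂)`;
* `flagContactFiltration_le_pure_sup_inf` — PURITY WITH BOTH ERROR TERMS: `F(r₁ν) ≤ P ⊔ ((𝔪·F(r₁ν − q) ⊔ F(r₁ν+1)) ⊓ F₃(j r₁ν + 1))`,
  `P = Σ_{r₁c + r₂b = r₁ν} (g₁^c g₂^b)`: `f = π + h` with `π` a combination of PURE flag monomials of exact weight and `h` negligible BOTH for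
  LEMMA B (original triple) and in the critical graded ring — the bridge that lets LEMMA B (`π ∉ ((g₁ − t g₂^ρ)^ν) + 𝔪F(r₁ν−q) + F(r₁ν+1)`)
  be read on the critical initial form `in₃(f) = in₃(π) ∈ κ[V, Y]`.

What remains for hres₃ after this file (memo RESIDUE-PLAN.md): the `inForm` bookkeeping in the critical graded ring `κ[X,V,Y]`
(`Literature…WeightedInitialForms`) and LEMMA C (pure algebra: `Φ ∈ κ[V,Y] ∩ κ[ēX^j + β̄V, λ̄Y + θ(X,V)]`, `ē ≠ 0`, `Φ ∋ Y^ν` ⇒ `Φ = u(Y − aV^ρ)^ν`).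
[OURS · L1 W4.3 · (o70-b)/(Δ12); AI work, weaker than expert review; nothing here is a statement of the manuscript under review.]
-/

noncomputable section

open IsLocalRing Literature.AlgebraicGeometry.Resolution
open Summit.ResolutionOfSingularities.ResolutionOfSingularities.Theorems

set_option linter.dupNamespace false -- mandated namespace of this single-conjunct summit

namespace Summit.ResolutionOfSingularities.ResolutionOfSingularities.Cruxes.HypersurfaceCentreConstruction.LocalEngine

namespace Iota3

universe u

/-! ## §1 Comparable critical filtrations -/

section Regular

variable {S : Type} [CommRing S] [IsRegularLocalRing S]

/-- **(E1) AT THE CRITICAL TRIPLE — the two flags have comparable critical filtrations.**  `S` regular local of dimension `3`,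
`𝔪 = (x, g₂, g₁)`, `0 < q`, `qj < r₂ < r₁`, `1 ≤ j`; `f ∉ 𝔪^{ν+1}` (`0 < ν`) in level `r₁ν` of the `(q;r₁,r₂)`-filtrations of `(g₁,g₂)` and of
`g₁', g₂' ∈ 𝔪`, and `g₂' ∈ F(qj)`.  Then `g₂' ∈ F₃(j r₂)`, `g₁' ∈ F₃(j r₁)` and `F'₃ ≤ F₃` for the critical triple `(r₂; j r₁, j r₂)`.
[OURS · L1 W4.3 · (o70-b)] -/
theorem critical_comparison (hdim : ringKrullDim S = 3) {x g₁ g₂ g₁' g₂' f : S} {q r₁ r₂ j ν : ℕ}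
    (h𝔪 : Ideal.span {x, g₂, g₁} = maximalIdeal S) (hq : 0 < q) (hj : 1 ≤ j) (hqj : q * j < r₂) (hr : r₂ < r₁) (hν : 0 < ν)
    (hf : f ∉ maximalIdeal S ^ (ν + 1)) (hF : f ∈ flagContactFiltration g₁ g₂ q r₁ r₂ (r₁ * ν))
    (hg₁' : g₁' ∈ maximalIdeal S) (hg₂' : g₂' ∈ maximalIdeal S) (hF' : f ∈ flagContactFiltration g₁' g₂' q r₁ r₂ (r₁ * ν))
    (hlev : g₂' ∈ flagContactFiltration g₁ g₂ q r₁ r₂ (q * j)) :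
    g₂' ∈ flagContactFiltration g₁ g₂ r₂ (j * r₁) (j * r₂) (j * r₂) ∧
      g₁' ∈ flagContactFiltration g₁ g₂ r₂ (j * r₁) (j * r₂) (j * r₁) ∧
      ∀ n, flagContactFiltration g₁' g₂' r₂ (j * r₁) (j * r₂) n ≤ flagContactFiltration g₁ g₂ r₂ (j * r₁) (j * r₂) n := by
  have hQ : 0 < r₂ := by omega
  have h₂ : g₂' ∈ flagContactFiltration g₁ g₂ r₂ (j * r₁) (j * r₂) (j * r₂) :=
    mem_critical_of_mem_level hq hj hqj.le hr.le hlev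
  have hF₃ : f ∈ flagContactFiltration g₁ g₂ r₂ (j * r₁) (j * r₂) (j * r₁ * ν) := mem_critical_of_mem hq hj hqj.le hF
  have hF'₃ : f ∈ flagContactFiltration g₁' g₂' r₂ (j * r₁) (j * r₂) (j * r₁ * ν) := mem_critical_of_mem hq hj hqj.le hF'
  have hq₂ : r₂ ≤ j * r₂ := Nat.le_mul_of_pos_left r₂ hj
  have hr₃ : j * r₂ < j * r₁ := Nat.mul_lt_mul_of_pos_left hr hj
  have h₁ : g₁' ∈ flagContactFiltration g₁ g₂ r₂ (j * r₁) (j * r₂) (j * r₁) :=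
    mem_weight₁_of_mem_weight₂ hdim h𝔪 hQ hq₂ hr₃ hν hf hF₃ hg₁' hg₂' hF'₃ h₂
  exact ⟨h₂, h₁, fun n => flagContactFiltration_le_of_mem hQ h₁ h₂ n⟩

end Regular

/-! ## §2 Purity with both error terms -/

variable {S : Type u} [CommRing S] [IsLocalRing S]

/-- **PURITY WITH BOTH ERROR TERMS.**  `0 < q`, `1 ≤ j`, `qj < r₂`:
`F(r₁ν) ≤ (⨆_{r₁α + r₂β = r₁ν} (g₁^α g₂^β)) ⊔ ((𝔪·F(r₁ν − q) ⊔ F(r₁ν + 1)) ⊓ F₃(j r₁ ν + 1))` — every non-pure piece of level `r₁ν` is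
negligible both for LEMMA B at `(q; r₁, r₂)` and in the critical graded ring. [OURS · L1 W4.3 · (o70-b)] -/
theorem flagContactFiltration_le_pure_sup_inf (g₁ g₂ : S) {q r₁ r₂ j : ℕ} (hq : 0 < q) (hj : 1 ≤ j) (hqj : q * j < r₂) (ν : ℕ) :
    flagContactFiltration g₁ g₂ q r₁ r₂ (r₁ * ν) ≤
      (⨆ α : ℕ, ⨆ β : ℕ, ⨆ (_ : r₁ * α + r₂ * β = r₁ * ν), Ideal.span {g₁ ^ α * g₂ ^ β}) ⊔
        ((maximalIdeal S * flagContactFiltration g₁ g₂ q r₁ r₂ (r₁ * ν - q) ⊔ flagContactFiltration g₁ g₂ q r₁ r₂ (r₁ * ν + 1)) ⊓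
          flagContactFiltration g₁ g₂ r₂ (j * r₁) (j * r₂) (j * r₁ * ν + 1)) := by
  have hQ : 0 < r₂ := by omega
  rw [flagContactFiltration_def g₁ g₂ q r₁ r₂ (r₁ * ν)]
  refine iSup_le fun α => iSup_le fun β => ?_
  by_cases heq : r₁ * α + r₂ * β = r₁ * ν
  · refine le_sup_of_le_left (le_iSup_of_le α (le_iSup_of_le β (le_iSup_of_le heq ?_)))
    have he : (r₁ * ν - r₁ * α - r₂ * β + q - 1) / q = 0 := by
      rw [show r₁ * ν - r₁ * α - r₂ * β = 0 by omega, zero_add]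
      exact Nat.div_eq_of_lt (by omega)
    rw [he, pow_zero, mul_one]
  · refine le_sup_of_le_right (le_inf ?_ ?_)
    · -- LEMMA B side: a non-pure piece lies in `𝔪·F(r₁ν − q)` (if below the level) or in `F(r₁ν + 1)` (if above)
      rcases lt_or_gt_of_ne heq with hlt | hgt
      · refine le_sup_of_le_left ?_
        have hk := le_mul_pieceExponent hq (r₁ * ν) r₁ r₂ α β
        obtain ⟨e, he⟩ : ∃ e : ℕ, (r₁ * ν - r₁ * α - r₂ * β + q - 1) / q = e := ⟨_, rfl⟩
        rw [he] at hk ⊢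
        clear he
        rcases Nat.eq_zero_or_pos e with he0 | he1
        · exfalso
          rw [he0, mul_zero, add_zero] at hk
          omega
        obtain ⟨e', he'⟩ : ∃ e' : ℕ, e = e' + 1 := ⟨e - 1, by omega⟩
        rw [he', pow_succ, ← mul_assoc, mul_comm _ (maximalIdeal S)]
        refine Ideal.mul_mono_right ?_
        rw [Ideal.mul_le]
        intro i hi m hm
        obtain ⟨d, rfl⟩ := Ideal.mem_span_singleton'.mp hi
        have heq' : d * (g₁ ^ α * g₂ ^ β) * m = g₁ ^ α * g₂ ^ β * (d * m) := by ring
        rw [heq']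
        refine mul_mem_flagContactFiltration_of_weight hq (Ideal.mul_mem_left _ d hm) ?_
        rw [he', Nat.mul_add, mul_one] at hk
        omega
      · refine le_sup_of_le_right ?_
        rw [Ideal.mul_le]
        intro i hi m hm
        obtain ⟨d, rfl⟩ := Ideal.mem_span_singleton'.mp hi
        have heq' : d * (g₁ ^ α * g₂ ^ β) * m = g₁ ^ α * g₂ ^ β * (d * m) := by ring
        rw [heq']
        exact mul_mem_flagContactFiltration_of_weight hq (Ideal.mul_mem_left _ d hm) (by omega)
    · -- critical side: as in `flagContactFiltration_le_pure_sup_critical`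
      rw [Ideal.mul_le]
      intro i hi m hm
      obtain ⟨d, rfl⟩ := Ideal.mem_span_singleton'.mp hi
      have heq' : d * (g₁ ^ α * g₂ ^ β) * m = g₁ ^ α * g₂ ^ β * (d * m) := by ring
      rw [heq']
      refine mul_mem_flagContactFiltration_of_weight hQ (Ideal.mul_mem_left _ d hm) ?_
      have hk := le_mul_pieceExponent hq (r₁ * ν) r₁ r₂ α β
      have hcase : r₁ * α + r₂ * β < r₁ * ν ∨ (r₁ * ν - r₁ * α - r₂ * β + q - 1) / q = 0 := by
        rcases lt_or_ge (r₁ * α + r₂ * β) (r₁ * ν) with h | h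
        · exact Or.inl h
        · right
          rw [show r₁ * ν - r₁ * α - r₂ * β = 0 by omega, zero_add]
          exact Nat.div_eq_of_lt (by omega)
      have := purity_weight hj hqj hk hcase heq
      linarith

/-- **The pure part carries everything.**  In the situation of hres₃ (`0 < q`, `1 ≤ j`, `qj < r₂`), an `f ∈ F(r₁ν)` splits as `f = π + h`
with `π ∈ Σ_{r₁α + r₂β = r₁ν} (g₁^α g₂^β)`, `h ∈ 𝔪·F(r₁ν − q) + F(r₁ν + 1)` AND `h ∈ F₃(j r₁ ν + 1)`. [OURS · L1 W4.3 · (o70-b)] -/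
theorem exists_pure_add {g₁ g₂ f : S} {q r₁ r₂ j ν : ℕ} (hq : 0 < q) (hj : 1 ≤ j) (hqj : q * j < r₂)
    (hf : f ∈ flagContactFiltration g₁ g₂ q r₁ r₂ (r₁ * ν)) :
    ∃ π h : S, f = π + h ∧ π ∈ (⨆ α : ℕ, ⨆ β : ℕ, ⨆ (_ : r₁ * α + r₂ * β = r₁ * ν), Ideal.span {g₁ ^ α * g₂ ^ β}) ∧
      h ∈ maximalIdeal S * flagContactFiltration g₁ g₂ q r₁ r₂ (r₁ * ν - q) ⊔ flagContactFiltration g₁ g₂ q r₁ r₂ (r₁ * ν + 1) ∧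
      h ∈ flagContactFiltration g₁ g₂ r₂ (j * r₁) (j * r₂) (j * r₁ * ν + 1) := by
  obtain ⟨π, hπ, h, hh, hsum⟩ := Submodule.mem_sup.mp (flagContactFiltration_le_pure_sup_inf g₁ g₂ hq hj hqj ν hf)
  exact ⟨π, h, hsum.symm, hπ, (Submodule.mem_inf.mp hh).1, (Submodule.mem_inf.mp hh).2⟩

/-- **LEMMA B transferred to the pure part**: if `f ∉ (z^ν) + 𝔪·F(r₁ν − q) + F(r₁ν + 1)` and `f = π + h` with `h` in the error ideal, then
`π ∉ (z^ν) + 𝔪·F(r₁ν − q) + F(r₁ν + 1)` — for any `z` (in the application `z = g₁ − t g₂^ρ`). [folklore] -/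
theorem pure_not_mem_of_not_mem {g₁ g₂ f π h z : S} {q r₁ r₂ ν : ℕ} (hsum : f = π + h)
    (hh : h ∈ maximalIdeal S * flagContactFiltration g₁ g₂ q r₁ r₂ (r₁ * ν - q) ⊔ flagContactFiltration g₁ g₂ q r₁ r₂ (r₁ * ν + 1))
    (hf : f ∉ Ideal.span {z ^ ν} ⊔ maximalIdeal S * flagContactFiltration g₁ g₂ q r₁ r₂ (r₁ * ν - q) ⊔
      flagContactFiltration g₁ g₂ q r₁ r₂ (r₁ * ν + 1)) :
    π ∉ Ideal.span {z ^ ν} ⊔ maximalIdeal S * flagContactFiltration g₁ g₂ q r₁ r₂ (r₁ * ν - q) ⊔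
      flagContactFiltration g₁ g₂ q r₁ r₂ (r₁ * ν + 1) := by
  intro hπ
  refine hf ?_
  rw [hsum]
  refine Ideal.add_mem _ hπ ?_
  rw [sup_assoc]
  exact Ideal.mem_sup_right hh

end Iota3

end Summit.ResolutionOfSingularities.ResolutionOfSingularities.Cruxes.HypersurfaceCentreConstruction.LocalEngine

end
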